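import Summits.CriticalPhenomena.SAWScalingLimit.Theorems.SAWRenewalTightnessTubeLowerBoundProfilePotentialDefs
import Summits.CriticalPhenomena.SAWScalingLimit.Theorems.SAWRenewalTightnessTubeLowerBoundQuarterFlux

/-!
# The half-plane first-visit cut: stub `stub_halfPlaneCut` of line `profile-potential`
(crux `SAWRenewalTightness.TubeLowerBound`, stmt-CriticalPhenomena-4730)

We prove `HalfPlaneCut` outright (no named facts, no new definitions): for all `R n`,

  `#hpWalks 0 n ≤ #slabWalks R n + Σ_{k ≤ n} #wallBridges R k · #hpWalks (R+1) (n−k)`.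

A weak half-plane self-avoiding walk `ω` from the wall point `0` (`x ≥ 0` throughout) is cut at its
FIRST visit `k` of the column `x = R+1` (the Simon–Lieb / Hammersley first-exit cut run in the
half-plane with the slab `[0,R] × ℤ` as inner set; B. Simon, Comm. Math. Phys. 77 (1980); E. Lieb,
Comm. Math. Phys. 77 (1980); N. Madras, G. Slade, *The Self-Avoiding Walk* (1993) §1.5).  The cut
time is `Nat.find (exists_hit_or_le R n ω)`: the first visit of the column, capped at `n`.

* Discrete continuity (`HalfPlaneCutProof.apply_le_of_forall_ne`): one lattice step changes the
  abscissa by at most one, so a walk from `0` which has not yet visited the column `x = R+1` has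
  abscissa `≤ R`.
* If `ω` never visits the column up to time `n` it is a slab walk (`stay_subset`).
* Otherwise the prefix up to `k` is a wall bridge of length `k` (`LiebSimon.prefix_mem_saws`), the
  suffix translated to `0` is an `(n−k)`-step walk with `x ≥ −(R+1)` (`LiebSimon.suffix_mem_saws`),
  and `ω ↦ ⟨k, (prefix, suffix)⟩` is injective (`card_cut_le`, as in `LiebSimon.count_le_cut`).
-/

noncomputable section

namespace Summit.CriticalPhenomena.SAWScalingLimit.Theorems.TubeLowerBound.ProfilePotential

open scoped BigOperators Classical
open Literature.Probability.LatticeModels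
open Literature.Probability.RandomPlanarGeometry Literature.Probability.RandomPlanarGeometry.SAW
open Summit.CriticalPhenomena.SAWScalingLimit.Theorems.TubeLowerBound.LiebSimonStar

namespace HalfPlaneCutProof

/-! ### The cut time `Nat.find (exists_hit_or_le R n ω)` -/

/-- There is always a time which is a visit of the column `x = R+1` or is `≥ n` (namely `n`); the
cut time of `ω` is `Nat.find` of this: its first visit of the column, capped at `n`. -/
theorem exists_hit_or_le (R n : ℕ) (ω : ℕ → Site 2) : ∃ i, ω i 0 = (R : ℤ) + 1 ∨ n ≤ i :=
  ⟨n, Or.inr le_rfl⟩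

/-- The cut time is at most `n`. -/
theorem cutTime_le (R n : ℕ) (ω : ℕ → Site 2) : Nat.find (exists_hit_or_le R n ω) ≤ n :=
  Nat.find_min' _ (Or.inr le_rfl)

/-- Before the cut time the walk does not visit the column `x = R+1`. -/
theorem ne_of_lt_cutTime {R n : ℕ} {ω : ℕ → Site 2} {i : ℕ}
    (hi : i < Nat.find (exists_hit_or_le R n ω)) : ω i 0 ≠ (R : ℤ) + 1 :=
  fun h => Nat.find_min (exists_hit_or_le R n ω) hi (Or.inl h)

/-- If the cut time is not a visit of the column, it equals `n`. -/
theorem cutTime_eq_of_ne {R n : ℕ} {ω : ℕ → Site 2}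
    (h : ω (Nat.find (exists_hit_or_le R n ω)) 0 ≠ (R : ℤ) + 1) :
    Nat.find (exists_hit_or_le R n ω) = n :=
  le_antisymm (cutTime_le R n ω) ((Nat.find_spec (exists_hit_or_le R n ω)).resolve_left h)

/-! ### Discrete continuity of the abscissa -/

/-- One lattice step raises the abscissa by at most one. -/
theorem apply_le_of_adj {x y : Site 2} (h : (zdGraph 2).Adj x y) : y 0 ≤ x 0 + 1 := by
  have h0 := Zd.abs_sub_le_one_of_adj h 0
  rw [abs_le] at h0
  linarith [h0.2]

/-- **Discrete continuity.** A self-avoiding walk from `0` which has not visited the column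
`x = R+1` up to time `i ≤ n` has abscissa `≤ R` at time `i`. -/
theorem apply_le_of_forall_ne {R n : ℕ} {ω : ℕ → Site 2} (hω : ω ∈ Zd.saws 2 n) :
    ∀ i ≤ n, (∀ j ≤ i, ω j 0 ≠ (R : ℤ) + 1) → ω i 0 ≤ (R : ℤ) := by
  obtain ⟨h0, -, hadj, -⟩ := Zd.mem_saws.1 hω
  intro i
  induction i with
  | zero =>
    intro _ _
    rw [h0, Pi.zero_apply]
    exact Int.natCast_nonneg R
  | succ i ih =>
    intro hi hne
    have h1 := ih (by omega) fun j hj => hne j (by omega)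
    have h2 := apply_le_of_adj (hadj i (by omega))
    have h3 := hne (i + 1) le_rfl
    omega

/-- Before the cut time the abscissa is `≤ R`. -/
theorem apply_le_of_lt_cutTime {R n : ℕ} {ω : ℕ → Site 2} (hω : ω ∈ Zd.saws 2 n) {i : ℕ}
    (hi : i < Nat.find (exists_hit_or_le R n ω)) : ω i 0 ≤ (R : ℤ) :=
  apply_le_of_forall_ne hω i ((Nat.le_of_lt hi).trans (cutTime_le R n ω))
    fun _ hj => ne_of_lt_cutTime (lt_of_le_of_lt hj hi)

/-- If the cut time is not a visit of the column (so the walk never visits it up to time `n`),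
the abscissa is `≤ R` throughout. -/
theorem apply_le_of_cutTime_ne {R n : ℕ} {ω : ℕ → Site 2} (hω : ω ∈ Zd.saws 2 n)
    (h : ω (Nat.find (exists_hit_or_le R n ω)) 0 ≠ (R : ℤ) + 1) : ∀ i ≤ n, ω i 0 ≤ (R : ℤ) := by
  have hk := cutTime_eq_of_ne h
  intro i hi
  refine apply_le_of_forall_ne hω i hi fun j hj => ?_
  rcases lt_or_eq_of_le (hj.trans hi) with hjn | rfl
  · exact ne_of_lt_cutTime (R := R) (n := n) (by rw [hk]; exact hjn)
  · rwa [hk] at h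

/-! ### Membership in the families of the Defs file -/

/-- Membership in `hpWalks 0 n`: a self-avoiding walk with `x ≥ 0` throughout. -/
theorem mem_hpWalks_zero {n : ℕ} {ω : ℕ → Site 2} :
    ω ∈ hpWalks 0 n ↔ ω ∈ Zd.saws 2 n ∧ ∀ i ≤ n, 0 ≤ ω i 0 := by
  rw [hpWalks, Finset.mem_filter]
  simp only [Nat.cast_zero, neg_zero]

/-- Case B, prefix: if the cut time `k` is a visit of the column, the prefix `i ↦ ω (min i k)` is
a wall bridge of length `k`. -/
theorem prefix_mem_wallBridges {R n : ℕ} {ω : ℕ → Site 2} (hω : ω ∈ hpWalks 0 n)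
    (hB : ω (Nat.find (exists_hit_or_le R n ω)) 0 = (R : ℤ) + 1) :
    (fun i => ω (min i (Nat.find (exists_hit_or_le R n ω)))) ∈
      wallBridges R (Nat.find (exists_hit_or_le R n ω)) := by
  obtain ⟨hs, hnn⟩ := mem_hpWalks_zero.1 hω
  have hkn := cutTime_le R n ω
  rw [wallBridges, Finset.mem_filter]
  refine ⟨LiebSimon.prefix_mem_saws hkn hs, fun i hi => ?_, ?_⟩
  · simp only [min_eq_left hi.le]
    exact ⟨hnn i (by omega), apply_le_of_lt_cutTime hs hi⟩
  · simp only [min_self]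
    exact hB

/-- Case B, suffix: if the cut time `k` is a visit of the column, the translated suffix
`j ↦ ω (k + min j (n−k)) − ω k` is an `(n−k)`-step self-avoiding walk with `x ≥ −(R+1)`. -/
theorem suffix_mem_hpWalks {R n : ℕ} {ω : ℕ → Site 2} (hω : ω ∈ hpWalks 0 n)
    (hB : ω (Nat.find (exists_hit_or_le R n ω)) 0 = (R : ℤ) + 1) :
    (fun j => ω (Nat.find (exists_hit_or_le R n ω) +
        min j (n - Nat.find (exists_hit_or_le R n ω))) - ω (Nat.find (exists_hit_or_le R n ω))) ∈
      hpWalks (R + 1) (n - Nat.find (exists_hit_or_le R n ω)) := by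
  obtain ⟨hs, hnn⟩ := mem_hpWalks_zero.1 hω
  have hkn := cutTime_le R n ω
  rw [hpWalks, Finset.mem_filter]
  refine ⟨LiebSimon.suffix_mem_saws hkn hs, fun j hj => ?_⟩
  simp only [min_eq_left hj, Pi.sub_apply, hB]
  have := hnn (Nat.find (exists_hit_or_le R n ω) + j) (by omega)
  push_cast
  omega

/-- A walk frozen after time `n` is determined by its prefix up to `k ≤ n` and its translated
suffix. -/
theorem eq_of_prefix_suffix_eq {n k : ℕ} {ω ω' : ℕ → Site 2} (hkn : k ≤ n)
    (hω : ω ∈ Zd.saws 2 n) (hω' : ω' ∈ Zd.saws 2 n)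
    (hπ : (fun i => ω (min i k)) = fun i => ω' (min i k))
    (hυ : (fun j => ω (k + min j (n - k)) - ω k) = fun j => ω' (k + min j (n - k)) - ω' k) :
    ω = ω' := by
  -- adapted from `LiebSimon.count_le_cut` / `SAW.Zd.count_add_le`
  have hfro := (Zd.mem_saws.1 hω).2.1
  have hfro' := (Zd.mem_saws.1 hω').2.1
  have hkk : ω k = ω' k := by simpa using congrFun hπ k
  funext i
  rcases le_or_gt i k with hi | hi
  · simpa [min_eq_left hi] using congrFun hπ i
  · obtain ⟨j, rfl⟩ : ∃ j, i = k + j := ⟨i - k, by omega⟩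
    rcases le_or_gt j (n - k) with hj | hj
    · have := congrFun hυ j
      simp only [min_eq_left hj] at this
      rwa [hkk, sub_left_inj] at this
    · have := congrFun hυ (n - k)
      simp only [min_self] at this
      rw [hkk, sub_left_inj, Nat.add_sub_of_le hkn] at this
      rw [hfro (k + j) (by omega), hfro' (k + j) (by omega), this]

/-! ### Counting -/

/-- Case A: the walks whose cut time is not a visit of the column are slab walks. -/
theorem stay_subset (R n : ℕ) :
    ((hpWalks 0 n).filter fun ω => ¬ω (Nat.find (exists_hit_or_le R n ω)) 0 = (R : ℤ) + 1) ⊆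
      slabWalks R n := by
  intro ω hω
  rw [Finset.mem_filter] at hω
  obtain ⟨hω, hA⟩ := hω
  obtain ⟨hs, hnn⟩ := mem_hpWalks_zero.1 hω
  rw [slabWalks, Finset.mem_filter]
  exact ⟨hs, fun i hi => ⟨hnn i hi, apply_le_of_cutTime_ne hs hA i hi⟩⟩

/-- Case B: cutting at the first visit of the column is an injection `ω ↦ ⟨k, (prefix, suffix)⟩`
of the walks which visit the column into the pairs (wall bridge of length `k ≤ n`, `(n−k)`-step
walk with `x ≥ −(R+1)`). -/
theorem card_cut_le (R n : ℕ) :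
    ((hpWalks 0 n).filter fun ω => ω (Nat.find (exists_hit_or_le R n ω)) 0 = (R : ℤ) + 1).card ≤
      ∑ k ∈ Finset.range (n + 1), (wallBridges R k).card * (hpWalks (R + 1) (n - k)).card := by
  calc ((hpWalks 0 n).filter fun ω => ω (Nat.find (exists_hit_or_le R n ω)) 0 = (R : ℤ) + 1).card
      ≤ ((Finset.range (n + 1)).sigma
          fun k => wallBridges R k ×ˢ hpWalks (R + 1) (n - k)).card :=
        Finset.card_le_card_of_injOn
          (fun ω => (⟨Nat.find (exists_hit_or_le R n ω),
            (fun i => ω (min i (Nat.find (exists_hit_or_le R n ω))), fun j =>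
              ω (Nat.find (exists_hit_or_le R n ω) +
                  min j (n - Nat.find (exists_hit_or_le R n ω))) -
                ω (Nat.find (exists_hit_or_le R n ω)))⟩ :
            Σ _ : ℕ, (ℕ → Site 2) × (ℕ → Site 2)))
          (fun ω hω => ?_) (fun ω hω ω' hω' h => ?_)
    _ = ∑ k ∈ Finset.range (n + 1), (wallBridges R k).card * (hpWalks (R + 1) (n - k)).card := by
        rw [Finset.card_sigma]
        exact Finset.sum_congr rfl fun k _ => Finset.card_product _ _
  · rw [Finset.mem_coe, Finset.mem_filter] at hω
    obtain ⟨hω, hB⟩ := hω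
    rw [Finset.mem_coe, Finset.mem_sigma, Finset.mem_range, Finset.mem_product]
    exact ⟨Nat.lt_succ_of_le (cutTime_le R n ω), prefix_mem_wallBridges hω hB,
      suffix_mem_hpWalks hω hB⟩
  · rw [Finset.mem_coe, Finset.mem_filter] at hω hω'
    have hs := (mem_hpWalks_zero.1 hω.1).1
    have hs' := (mem_hpWalks_zero.1 hω'.1).1
    simp only [Sigma.mk.injEq, heq_eq_eq, Prod.mk.injEq] at h
    obtain ⟨hk, hπ, hυ⟩ := h
    rw [← hk] at hπ hυ
    exact eq_of_prefix_suffix_eq (cutTime_le R n ω) hs hs' hπ hυ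

/-- The cut, in natural numbers: `#hpWalks 0 n ≤ #slabWalks R n + Σ_{k ≤ n} #wallBridges R k ·
#hpWalks (R+1) (n−k)`. -/
theorem card_hpWalks_le (R n : ℕ) :
    (hpWalks 0 n).card ≤
      (slabWalks R n).card +
        ∑ k ∈ Finset.range (n + 1), (wallBridges R k).card * (hpWalks (R + 1) (n - k)).card := by
  have hsplit := Finset.card_filter_add_card_filter_not (s := hpWalks 0 n)
    (fun ω => ω (Nat.find (exists_hit_or_le R n ω)) 0 = (R : ℤ) + 1)
  have h1 := Finset.card_le_card (stay_subset R n)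
  have h2 := card_cut_le R n
  omega

end HalfPlaneCutProof

/-- **`HalfPlaneCut`** (stub S5 of line `profile-potential`, PROVED): for all `R n`,
`#hpWalks 0 n ≤ #slabWalks R n + Σ_{k ≤ n} #wallBridges R k · #hpWalks (R+1) (n−k)` — cut a weak
half-plane walk from the wall point at its first visit of the column `x = R+1`: either there is
no visit and the walk is a slab walk, or the prefix is a wall bridge and the translated suffix
has `x ≥ −(R+1)`, injectively. -/
theorem stub_halfPlaneCut : HalfPlaneCut := by
  intro R n
  exact_mod_cast HalfPlaneCutProof.card_hpWalks_le R n

end Summit.CriticalPhenomena.SAWScalingLimit.Theorems.TubeLowerBound.ProfilePotential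

end
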